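import Literature.AlgebraicGeometry.Morphisms.GeometricallyConnectedOfSection
import HarnessLib

/-!
# Roots of unity of order invertible on a connected scheme are rigid

Layer `Literature/AlgebraicGeometry/Morphisms`, namespace `Literature.AlgebraicGeometry.Morphisms`.  THEOREMS ONLY
(no definition, no named fact, no instance).

Let `X` be a connected scheme and `n` invertible in `Γ(X, 𝒪_X)`.  A global function `ζ` with `ζ ^ n = 1` which
takes the value `1` at ONE point (through any ring map `Γ(X, 𝒪_X) → K` to a non-trivial ring, e.g. the pull-back
along a field-valued point `Spec K → X`) is equal to `1`: the averaging element `e := n⁻¹ · Σ_{i<n} ζ^i` is an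
idempotent (`ζ · e = e`), hence `0` or `1` on a connected scheme (★ `Morphisms.eq_zero_or_one_of_isIdempotentElem`);
it maps to `n⁻¹ · n = 1 ≠ 0`, so `e = 1` and `ζ = ζ · e = e = 1`.  This is the classical rigidity «`μ_n` is (finite)
étale over `ℤ[1/n]`, so a section over a connected base is determined by its value at one point»
([SGA1] Exp. I Cor. 5.4 with Exp. V §1; [GortzWedhorn2020] Prop. 9.3 / (4.7)) in the elementary form the cell
`hodgecm-mathlib` needs for the HECKE-LINK brick (K4) «the `K`-descent character of `π^*𝒫_c` is locally constant»
(B-plan1 (g14) 21:39:01Z (P2)).  Count-neutral; HC_CM is proved only modulo the 7 printed citations until rung 0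
closes — nothing here is about HC.

* §1 `eq_one_of_pow_eq_one_of_map_eq_one` — the ring statement: all idempotents of `R` trivial, `n ∈ Rˣ`,
  `ζ ^ n = 1`, `φ ζ = 1` for a ring map `φ : R →+* S` to a non-trivial `S` ⇒ `ζ = 1`.
* §2 `eq_one_of_pow_eq_one_of_appTop_eq_one` — the scheme statement for a connected `X` and a field-valued point
  `t : Spec K ⟶ X`; `eq_of_pow_eq_of_appTop_eq` — two `n`-th roots of unity agreeing at one point agree.

## References
* [SGA1] A. Grothendieck, *Revêtements étales et groupe fondamental* (SGA 1), Exp. I Cor. 5.4, Exp. V §1.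
* [GortzWedhorn2020] U. Görtz, T. Wedhorn, *Algebraic Geometry I* (2nd ed. 2020), Prop. 9.3, Section (4.7).
-/

set_option autoImplicit false

noncomputable section

universe u

open CategoryTheory AlgebraicGeometry

namespace Literature.AlgebraicGeometry.Morphisms

/-! ## §1 The ring statement -/

/-- **Rigidity of roots of unity, ring form.** In a commutative ring `R` all of whose idempotents are trivial, with
`n` invertible, an `n`-th root of unity `ζ` which becomes `1` under some ring map to a non-trivial ring is `1`:
`e := n⁻¹ Σ_{i<n} ζ^i` is an idempotent with `ζ e = e` and image `1`, so `e = 1` and `ζ = ζ e = 1`.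
[cite: SGA1, Exp. I Cor. 5.4] -/
theorem eq_one_of_pow_eq_one_of_map_eq_one {R S : Type*} [CommRing R] [CommRing S] [Nontrivial S]
    (hR : ∀ e : R, IsIdempotentElem e → e = 0 ∨ e = 1) {n : ℕ} (hn : IsUnit (n : R)) {ζ : R}
    (hζ : ζ ^ n = 1) (φ : R →+* S) (hφ : φ ζ = 1) : ζ = 1 := by
  obtain ⟨u, hu⟩ := hn
  -- the sum `s = Σ_{i<n} ζ^i` is `ζ`-stable
  set s : R := ∑ i ∈ Finset.range n, ζ ^ i with hs
  have hζs : ζ * s = s := by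
    have h1 : ∑ i ∈ Finset.range (n + 1), ζ ^ i = (∑ i ∈ Finset.range n, ζ ^ (i + 1)) + ζ ^ 0 :=
      Finset.sum_range_succ' (fun i => ζ ^ i) n
    have h2 : ∑ i ∈ Finset.range (n + 1), ζ ^ i = (∑ i ∈ Finset.range n, ζ ^ i) + ζ ^ n :=
      Finset.sum_range_succ (fun i => ζ ^ i) n
    rw [hs, Finset.mul_sum]
    simp_rw [← pow_succ']
    have h3 : (∑ i ∈ Finset.range n, ζ ^ (i + 1)) = (∑ i ∈ Finset.range n, ζ ^ i) + ζ ^ n - ζ ^ 0 := by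
      rw [← h2, h1]; ring
    rw [h3, hζ, pow_zero, add_sub_cancel_right]
  have hpow : ∀ i : ℕ, ζ ^ i * s = s := by
    intro i
    induction i with
    | zero => rw [pow_zero, one_mul]
    | succ i ih => rw [pow_succ, mul_assoc, hζs, ih]
  have hss : s * s = (n : R) * s :=
    calc s * s = (∑ i ∈ Finset.range n, ζ ^ i) * s := rfl
      _ = ∑ i ∈ Finset.range n, ζ ^ i * s := Finset.sum_mul _ _ _
      _ = ∑ i ∈ Finset.range n, s := Finset.sum_congr rfl fun i _ => hpow i
      _ = (n : R) * s := by rw [Finset.sum_const, Finset.card_range, nsmul_eq_mul]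
  -- the averaging idempotent
  set e : R := (↑u⁻¹ : R) * s with he
  have hue : (↑u⁻¹ : R) * (n : R) = 1 := by rw [← hu, Units.inv_mul]
  have hidem : IsIdempotentElem e := by
    change e * e = e
    calc e * e = (↑u⁻¹ : R) * (↑u⁻¹ : R) * (s * s) := by rw [he]; ring
      _ = (↑u⁻¹ : R) * ((↑u⁻¹ : R) * (n : R)) * s := by rw [hss]; ring
      _ = e := by rw [hue, mul_one]
  have hζe : ζ * e = e := by rw [he, mul_left_comm, hζs]
  -- its image is `1`
  have hφs : φ s = (n : S) := by
    rw [hs, map_sum]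
    simp_rw [map_pow, hφ, one_pow]
    rw [Finset.sum_const, Finset.card_range, nsmul_eq_mul, mul_one]
  have hφe : φ e = 1 := by
    rw [he, map_mul, hφs, ← map_natCast φ n, ← map_mul, hue, map_one]
  rcases hR e hidem with h0 | h1
  · rw [h0, map_zero] at hφe
    exact absurd hφe zero_ne_one
  · rw [← mul_one ζ, ← h1, hζe]

/-- **Two roots of unity agreeing at one point agree, ring form**: `ζ₂` is a unit with inverse `ζ₂^(n-1)`, and
`ζ₁ ζ₂^(n-1)` is an `n`-th root of unity mapping to `1`. [cite: SGA1, Exp. I Cor. 5.4] -/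
theorem eq_of_pow_eq_one_of_map_eq {R S : Type*} [CommRing R] [CommRing S] [Nontrivial S]
    (hR : ∀ e : R, IsIdempotentElem e → e = 0 ∨ e = 1) {n : ℕ} (hn : IsUnit (n : R)) {ζ₁ ζ₂ : R}
    (hζ₁ : ζ₁ ^ n = 1) (hζ₂ : ζ₂ ^ n = 1) (φ : R →+* S) (hφ : φ ζ₁ = φ ζ₂) : ζ₁ = ζ₂ := by
  rcases Nat.eq_zero_or_pos n with hn0 | hnpos
  · -- `n = 0`: `0` is a unit, so `R` is trivial
    subst hn0
    obtain ⟨u, hu⟩ := hn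
    have h10 : (1 : R) = 0 := by rw [← Units.mul_inv u, hu, Nat.cast_zero, zero_mul]
    haveI := subsingleton_of_zero_eq_one h10.symm
    exact Subsingleton.elim _ _
  -- `w := ζ₂^(n-1)` is the inverse of `ζ₂`
  set w : R := ζ₂ ^ (n - 1) with hw
  have hwζ : w * ζ₂ = 1 := by
    rw [hw, ← pow_succ, Nat.sub_add_cancel hnpos, hζ₂]
  have hζ : (ζ₁ * w) ^ n = 1 := by
    rw [mul_pow, hζ₁, one_mul, hw, ← pow_mul, mul_comm, pow_mul, hζ₂, one_pow]
  have hφw : φ (ζ₁ * w) = 1 := by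
    rw [map_mul, hφ, ← map_mul, mul_comm, hwζ, map_one]
  have h := eq_one_of_pow_eq_one_of_map_eq_one hR hn hζ φ hφw
  calc ζ₁ = ζ₁ * (w * ζ₂) := by rw [hwζ, mul_one]
    _ = ζ₁ * w * ζ₂ := by rw [mul_assoc]
    _ = ζ₂ := by rw [h, one_mul]

/-! ## §2 The scheme statements -/

/-- `Γ(Spec K, 𝒪)` is a non-trivial ring for a field `K` (it is `K`). [cite: GortzWedhorn2020, Section (4.7)] -/
theorem nontrivial_ΓSpec_of_field (K : Type u) [Field K] : Nontrivial Γ(Spec (.of K), ⊤) :=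
  (Scheme.ΓSpecIso (.of K)).commRingCatIsoToRingEquiv.toEquiv.nontrivial

/-- **Rigidity of roots of unity on a connected scheme.** Let `X` be connected, `n` invertible in `Γ(X, 𝒪_X)`, and
`ζ ∈ Γ(X, 𝒪_X)` with `ζ ^ n = 1`.  If `ζ` pulls back to `1` along ONE field-valued point `t : Spec K ⟶ X`, then
`ζ = 1` (`μ_n` is étale over `ℤ[1/n]`: a section over a connected base is determined at one point; elementary proof
through the averaging idempotent `n⁻¹ Σ ζ^i` and ★ `eq_zero_or_one_of_isIdempotentElem`).
[cite: SGA1, Exp. I Cor. 5.4] [cite: GortzWedhorn2020, Prop. 9.3] -/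
theorem eq_one_of_pow_eq_one_of_appTop_eq_one (X : Scheme.{u}) [PreconnectedSpace X] (ζ : Γ(X, ⊤)) {n : ℕ}
    (hn : IsUnit (n : Γ(X, ⊤))) (hζ : ζ ^ n = 1) {K : Type u} [Field K] (t : Spec (.of K) ⟶ X)
    (ht : t.appTop ζ = 1) : ζ = 1 :=
  haveI := nontrivial_ΓSpec_of_field K
  eq_one_of_pow_eq_one_of_map_eq_one (eq_zero_or_one_of_isIdempotentElem X) hn hζ t.appTop.hom ht

/-- **Two `n`-th roots of unity on a connected scheme (`n` invertible) which agree at one field-valued point are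
equal.** [cite: SGA1, Exp. I Cor. 5.4] [cite: GortzWedhorn2020, Prop. 9.3] -/
theorem eq_of_pow_eq_one_of_appTop_eq (X : Scheme.{u}) [PreconnectedSpace X] (ζ₁ ζ₂ : Γ(X, ⊤)) {n : ℕ}
    (hn : IsUnit (n : Γ(X, ⊤))) (hζ₁ : ζ₁ ^ n = 1) (hζ₂ : ζ₂ ^ n = 1) {K : Type u} [Field K]
    (t : Spec (.of K) ⟶ X) (ht : t.appTop ζ₁ = t.appTop ζ₂) : ζ₁ = ζ₂ :=
  haveI := nontrivial_ΓSpec_of_field K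
  eq_of_pow_eq_one_of_map_eq (eq_zero_or_one_of_isIdempotentElem X) hn hζ₁ hζ₂ t.appTop.hom ht

/-- **Unit form**: an `n`-torsion unit of `Γ(X, 𝒪_X)` on a connected `X` (`n` invertible) which is `1` at one
field-valued point is `1`. [cite: SGA1, Exp. I Cor. 5.4] -/
theorem units_eq_one_of_pow_eq_one_of_appTop_eq_one (X : Scheme.{u}) [PreconnectedSpace X] (ζ : Γ(X, ⊤)ˣ)
    {n : ℕ} (hn : IsUnit (n : Γ(X, ⊤))) (hζ : ζ ^ n = 1) {K : Type u} [Field K] (t : Spec (.of K) ⟶ X)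
    (ht : t.appTop (ζ : Γ(X, ⊤)) = 1) : ζ = 1 :=
  Units.ext (eq_one_of_pow_eq_one_of_appTop_eq_one X (ζ : Γ(X, ⊤)) hn
    (by rw [← Units.val_pow_eq_pow_val, hζ, Units.val_one]) t ht)

end Literature.AlgebraicGeometry.Morphisms

end
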